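import Mathlib
import HarnessLib
import Summits.ValiantsHypothesis.ValiantsHypothesis.Theses.MonotoneRestoration
import Literature.Computability.AlgebraicComplexity.ArithCircuit
import Literature.Computability.AlgebraicComplexity.ArithCircuitProofs
import Literature.Computability.AlgebraicComplexity.MonotoneStructure
import Literature.Computability.AlgebraicComplexity.PermanentIrreducible
import Literature.ModelTheory.FiniteModelTheory.CkEquiv
import Summits.ValiantsHypothesis.ValiantsHypothesis.Theorems.MonotoneRestorationMonotoneRestorationQPCosetCount
import Summits.ValiantsHypothesis.ValiantsHypothesis.Theorems.MonotoneRestorationMonotoneRestorationQPSymmetricLB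
import Summits.ValiantsHypothesis.ValiantsHypothesis.Theorems.MonotoneRestorationMonotoneRestorationQPSupportSymmetrisation
import Summits.ValiantsHypothesis.ValiantsHypothesis.Theorems.MonotoneRestorationMonotoneRestorationQPSparseRegime
import Summits.ValiantsHypothesis.ValiantsHypothesis.Theorems.MonotoneRestorationMonotoneRestorationQPBeta
import Literature.Computability.AlgebraicComplexity.SymmetricArithCircuit
import Literature.Computability.AlgebraicComplexity.DawarWilsenach2025Proofs
import Literature.GroupTheory.PermutationGroups.SmallIndexSubgroups
import Summits.ValiantsHypothesis.ValiantsHypothesis.Theorems.MonotoneRestorationQP.Negative.LoadBearing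
import Summits.ValiantsHypothesis.ValiantsHypothesis.Theorems.MonotoneRestorationMonotoneRestorationQPPermSupportCount

/-! TTRL-lite variant V19241 of stmt-ValiantsHypothesis-15886 -/

set_option linter.dupNamespace false

namespace Summit.ValiantsHypothesis.ValiantsHypothesis.Theorems

open Summit.ValiantsHypothesis.ValiantsHypothesis.Theses.MonotoneRestoration
open Literature.Computability.AlgebraicComplexity

/-- TTRL-lite variant V19241 of `stmt-ValiantsHypothesis-15886` (one-gate steps of a
straight-line program): if `p` and `q` are both values of gates of the gate list `gs`, read at
indices `a` and `b`, then appending the single fan-in-two gate `sum [(1, gate a), (1, gate b)]`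
(resp. `prod [gate a, gate b]`) provides the value `p + q` (resp. `p * q`); the earlier values are
unchanged (`ArithCircuit.gateValues_append_singleton`). [cite: Burgisser2000, Def. 2.1] -/
theorem stub_esymmRowSums_complexity_var19241 :
    ∀ (σ : Type) (gs : List (ArithCircuit.Gate NNReal σ)) (p q : MvPolynomial σ NNReal),
      p ∈ ArithCircuit.gateValues gs → q ∈ ArithCircuit.gateValues gs →
      (∃ g : ArithCircuit.Gate NNReal σ, g.fanIn ≤ 2 ∧
        p + q ∈ ArithCircuit.gateValues (gs ++ [g])) ∧
      (∃ g : ArithCircuit.Gate NNReal σ, g.fanIn ≤ 2 ∧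
        p * q ∈ ArithCircuit.gateValues (gs ++ [g])) := by
  intro σ gs p q hp hq
  obtain ⟨a, ha, rfl⟩ := List.getElem_of_mem hp
  obtain ⟨b, hb, rfl⟩ := List.getElem_of_mem hq
  refine ⟨⟨.sum [(1, .gate a), (1, .gate b)], ?_, ?_⟩, ⟨.prod [.gate a, .gate b], ?_, ?_⟩⟩
  · simp [ArithCircuit.Gate.fanIn, ArithCircuit.Gate.args]
  · rw [ArithCircuit.gateValues_append_singleton]
    refine List.mem_append_right _ (List.mem_singleton.mpr ?_)
    simp [ArithCircuit.Gate.eval, ArithCircuit.Operand.eval, List.getD_eq_getElem?_getD,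
      List.getElem?_eq_getElem ha, List.getElem?_eq_getElem hb]
  · simp [ArithCircuit.Gate.fanIn, ArithCircuit.Gate.args]
  · rw [ArithCircuit.gateValues_append_singleton]
    refine List.mem_append_right _ (List.mem_singleton.mpr ?_)
    simp [ArithCircuit.Gate.eval, ArithCircuit.Operand.eval, List.getD_eq_getElem?_getD,
      List.getElem?_eq_getElem ha, List.getElem?_eq_getElem hb]

end Summit.ValiantsHypothesis.ValiantsHypothesis.Theorems
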